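import Mathlib
import HarnessLib
import Summits.HubbardSuperconductivity.HubbardSuperconductivity.Theorems.KLProgrammeSWaveCascadeMatrixEdge

/-!
# Route `KLProgramme` — row 0′ (child 1), CARRIER-GENERIC, ALL scales: the envelope of an amplitude family at one total-momentum class from
# signed right-inverse ladder steps INSIDE the class and gained increments AFTER the class exit (the shape of `pairArray_envelope_edge`)

Cell gate-hubbard-kl, seat hubbard-kl-k3c1-p2 (child-1 re-closure owner; technique «row-0′ V4/S twin induction measured from its own constant»).
This is `pairArray_envelope_edge` (`…SplitPairArrayEdge`, p473743) together with p3's frozen part `pairFrozen_increment_extra` (`…SplitPairFrozen`)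
with the MODEL CARRIER ABSTRACTED — proofs adapted from those files.  Parameters: a finite index type `S`, a ball `B`, an amplitude family
`𝒜 : ℕ → S → S → ℂ` (model: `klPairAmplitude … j Qm`, or the Wick-ordered `klWickPairAmplitude … j Qm`, at ONE total momentum `Qm`), a class
predicate `InClass : ℕ → Prop` antitone in the scale (model: `IsPairClassAt L Qm`), the in-class ladder budget `τ`, the increment budget
`g j k k' + ε (j−1) + X j k k'` with the frozen-gain line `Σ_{j∈(t,n]} g j ≤ Gtot` past the exit `¬ InClass (t+1)` (model: `(Klam U)²·3CF` from
`G.WF`'s gain sums), the extra family `X` with its three lines, the sign-defect profile `δ` with the negative-mass line at every in-class scale, and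
the no-onset smallness.  Conclusion: `∃ u ∈ [0, (16/15)·U]` with `‖𝒜 n k k' − u‖ ≤ 12·((ι₀ + Στ + Xtot) + (Στ + Xsup)) + (Gtot + Xtot + Σ_{i<n} ε i)`
on `B × B`.  PURPOSE: as `…SWaveCascadeMatrixEdge` — one ≈ 60-line instance per value carrier (plain: `pairArray_envelope_edge`; Wick: p1 g8's
E2-STRUCTURE options (A)/(B)/(C)).  **`amplitudeFrozen_increment`**, **`amplitudeArray_envelope_edge`**.  Everything is proved; no definitions.
-/

noncomputable section

namespace Summit.HubbardSuperconductivity.HubbardSuperconductivity.Theorems.SWaveCascade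

set_option linter.dupNamespace false -- summit = problem name (single-conjunct summit), D-0017

open Finset

variable {S : Type*} [Fintype S] [DecidableEq S]

omit [Fintype S] [DecidableEq S] in
/-- **The frozen part, carrier-generic** (p3's `pairFrozen_increment_extra` abstracted): if `‖𝒜 j k k' − 𝒜 (j−1) k k'‖ ≤ g j k k' + ε (j−1) + X j k k'`
for `t < j ≤ n`, `ε ≥ 0`, `X ≥ 0`, `Σ_{j∈(t,n]} g j k k' ≤ Gtot` and `Σ_{j∈(t,n]} X j k k' ≤ Xtot`, then
`‖𝒜 n k k' − 𝒜 t k k'‖ ≤ Gtot + Xtot + Σ_{i<n} ε i`. -/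
theorem amplitudeFrozen_increment (𝒜 : ℕ → S → S → ℂ) {t n : ℕ} (htn : t ≤ n) (g X : ℕ → S → S → ℝ) (ε : ℕ → ℝ)
    (hε0 : ∀ j, 0 ≤ ε j) {Gtot Xtot : ℝ} {k k' : S}
    (hincr : ∀ j, t < j → j ≤ n → ‖𝒜 j k k' - 𝒜 (j - 1) k k'‖ ≤ g j k k' + ε (j - 1) + X j k k')
    (hg : ∑ j ∈ Ioc t n, g j k k' ≤ Gtot) (hX : ∑ j ∈ Ioc t n, X j k k' ≤ Xtot) :
    ‖𝒜 n k k' - 𝒜 t k k'‖ ≤ Gtot + Xtot + ∑ i ∈ range n, ε i := by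
  have key : ∀ m, t ≤ m → m ≤ n → ‖𝒜 m k k' - 𝒜 t k k'‖ ≤
      ∑ j ∈ Ioc t m, g j k k' + ∑ j ∈ Ioc t m, X j k k' + ∑ i ∈ Ico t m, ε i := by
    intro m htm
    induction m, htm using Nat.le_induction with
    | base => intro; simp
    | succ m htm ih =>
      intro hmn
      have ih' := ih (Nat.le_of_succ_le hmn)
      have hstep := hincr (m + 1) (Nat.lt_succ_of_le htm) hmn
      simp only [Nat.add_sub_cancel] at hstep
      rw [sum_Ioc_succ_top (by omega), sum_Ioc_succ_top (by omega), sum_Ico_succ_top htm]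
      have htri : ‖𝒜 (m + 1) k k' - 𝒜 t k k'‖ ≤ ‖𝒜 (m + 1) k k' - 𝒜 m k k'‖ + ‖𝒜 m k k' - 𝒜 t k k'‖ := by
        rw [show 𝒜 (m + 1) k k' - 𝒜 t k k' = (𝒜 (m + 1) k k' - 𝒜 m k k') + (𝒜 m k k' - 𝒜 t k k') by ring]
        exact norm_add_le _ _
      linarith
  have hfin := key n htn le_rfl
  have hε : ∑ i ∈ Ico t n, ε i ≤ ∑ i ∈ range n, ε i :=
    sum_le_sum_of_subset_of_nonneg (fun i hi => by simp only [mem_Ico] at hi; exact mem_range.2 hi.2) fun i _ _ => hε0 i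
  linarith

/-- **Row 0′ at one total-momentum class, ALL scales, for an arbitrary amplitude family** (the shape of `pairArray_envelope_edge`).  See the module
docstring for the parameters.  The in-class ladder steps are stated with right inverses of `1 + diag(w)·[𝒜 (j−1)]_B`, `[·]_B` the ball truncation
`Matrix.of (fun s t => if s ∈ B ∧ t ∈ B then · s t else 0)`. -/
theorem amplitudeArray_envelope_edge (B : Finset S) (𝒜 : ℕ → S → S → ℂ) (InClass : ℕ → Prop) [DecidablePred InClass]
    (hmono : ∀ {j m : ℕ}, InClass m → j ≤ m → InClass j)
    {U b ι₀ Gtot : ℝ} (hU : 0 ≤ U) (hb : 0 ≤ b) (hι₀ : 0 ≤ ι₀) (hGtot0 : 0 ≤ Gtot) (τ ε : ℕ → ℝ) (hτ0 : ∀ j, 0 ≤ τ j)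
    (hε0 : ∀ j, 0 ≤ ε j) {n : ℕ} (g X : ℕ → S → S → ℝ) {Xtot Xsup : ℝ}
    (hX0 : ∀ j k k', 0 ≤ X j k k') (hXtot0 : 0 ≤ Xtot) (hXsup0 : 0 ≤ Xsup) (hXsup : ∀ j k k', X j k k' ≤ Xsup)
    (hXsum : ∀ (t : ℕ) (k k' : S), ∑ j ∈ Ioc t n, X j k k' ≤ Xtot)
    (hXtot : ∀ k k' : S, X 0 k k' + ∑ i ∈ range n, X (i + 1) k k' ≤ Xtot)
    (δ : ℕ → ℝ) (hneg : ∀ t ≤ n, InClass t → 16 * U * ∑ i ∈ range t, δ (i + 1) ≤ 1)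
    (h0 : ∀ k ∈ B, ∀ k' ∈ B, ‖𝒜 0 k k' - (U : ℂ)‖ ≤ ι₀ + X 0 k k')
    (hsteps : ∀ j, 1 ≤ j → j ≤ n → InClass j →
      ∃ w : S → ℝ, (∑ p, |w p| ≤ b) ∧ (∑ p, (|w p| - w p) ≤ δ j) ∧
        ∃ N : Matrix S S ℂ,
          (1 + Matrix.diagonal (fun p => (w p : ℂ)) * Matrix.of (fun s t => if s ∈ B ∧ t ∈ B then 𝒜 (j - 1) s t else 0)) * N = 1 ∧
          ∀ k ∈ B, ∀ k' ∈ B,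
            ‖𝒜 j k k' - (Matrix.of (fun s t => if s ∈ B ∧ t ∈ B then 𝒜 (j - 1) s t else 0) * N) k k'‖ ≤ τ (j - 1) + X j k k')
    (hincr : ∀ j, 1 ≤ j → j ≤ n → ∀ k ∈ B, ∀ k' ∈ B, ‖𝒜 j k k' - 𝒜 (j - 1) k k'‖ ≤ g j k k' + ε (j - 1) + X j k k')
    (hg : ∀ t ≤ n, ¬ InClass (t + 1) → ∀ k ∈ B, ∀ k' ∈ B, ∑ j ∈ Ioc t n, g j k k' ≤ Gtot)
    (hsmall : 8 * 42 * ((ι₀ + ∑ j ∈ range n, τ j + Xtot) + (∑ j ∈ range n, τ j + Xsup)) * (b * n) ≤ 1) :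
    ∃ u : ℝ, 0 ≤ u ∧ u ≤ 16 / 15 * U ∧ ∀ k ∈ B, ∀ k' ∈ B,
      ‖𝒜 n k k' - (u : ℂ)‖ ≤
        12 * ((ι₀ + ∑ j ∈ range n, τ j + Xtot) + (∑ j ∈ range n, τ j + Xsup)) + (Gtot + Xtot + ∑ i ∈ range n, ε i) := by
  classical
  have hSe0 : 0 ≤ ∑ i ∈ range n, ε i := sum_nonneg fun i _ => hε0 i
  have hSτ0 : 0 ≤ ∑ j ∈ range n, τ j := sum_nonneg fun j _ => hτ0 j
  -- the frozen part between two scales `t ≤ n` once the class is left at `t + 1`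
  have hfrozen : ∀ t, t ≤ n → ¬ InClass (t + 1) → ∀ k ∈ B, ∀ k' ∈ B,
      ‖𝒜 n k k' - 𝒜 t k k'‖ ≤ Gtot + Xtot + ∑ i ∈ range n, ε i := by
    intro t htn hexit k hk k' hk'
    exact amplitudeFrozen_increment 𝒜 htn g X ε hε0 (fun j hj hjn => hincr j (by omega) hjn k hk k' hk')
      (hg t htn hexit k hk k' hk') (hXsum t k k')
  by_cases hQ0 : InClass 0
  · -- the last in-class scale `t`
    set t : ℕ := Nat.findGreatest (fun s => InClass s) n with ht_def
    have htn : t ≤ n := Nat.findGreatest_le n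
    have hQt : InClass t := Nat.findGreatest_spec (P := fun s => InClass s) (Nat.zero_le n) hQ0
    have hSt : ∑ j ∈ range t, τ j ≤ ∑ j ∈ range n, τ j :=
      sum_le_sum_of_subset_of_nonneg (range_mono htn) fun j _ _ => hτ0 j
    have hSt0 : 0 ≤ ∑ j ∈ range t, τ j := sum_nonneg fun j _ => hτ0 j
    -- the ladder data up to `t`
    have hsteps' : ∀ i < t, ∃ w : S → ℝ, (∑ p, |w p| ≤ b) ∧ (∑ p, (|w p| - w p) ≤ δ (i + 1)) ∧
        ∃ N : Matrix S S ℂ,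
          (1 + Matrix.diagonal (fun p => (w p : ℂ)) * Matrix.of (fun s t => if s ∈ B ∧ t ∈ B then 𝒜 i s t else 0)) * N = 1 ∧
          ∀ k ∈ B, ∀ k' ∈ B,
            ‖𝒜 (i + 1) k k' - (Matrix.of (fun s t => if s ∈ B ∧ t ∈ B then 𝒜 i s t else 0) * N) k k'‖ ≤ τ i + X (i + 1) k k' := by
      intro i hi
      have h := hsteps (i + 1) (Nat.le_add_left 1 i) ((Nat.succ_le_of_lt hi).trans htn) (hmono hQt (Nat.succ_le_of_lt hi))
      simp only [Nat.add_sub_cancel] at h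
      exact h
    have hXtot' : ∀ k k' : S, X 0 k k' + ∑ i ∈ range t, X (i + 1) k k' ≤ Xtot := fun k k' =>
      (add_le_add le_rfl (sum_le_sum_of_subset_of_nonneg (range_mono htn) fun i _ _ => hX0 _ _ _)).trans (hXtot k k')
    have hsmall' : 8 * 42 * ((ι₀ + ∑ j ∈ range t, τ j + Xtot) + (∑ j ∈ range t, τ j + Xsup)) * (b * t) ≤ 1 := by
      refine le_trans ?_ hsmall
      have ht' : (t : ℝ) ≤ n := by exact_mod_cast htn
      have h1 : (ι₀ + ∑ j ∈ range t, τ j + Xtot) + (∑ j ∈ range t, τ j + Xsup) ≤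
          (ι₀ + ∑ j ∈ range n, τ j + Xtot) + (∑ j ∈ range n, τ j + Xsup) := by linarith
      have hX0' : 0 ≤ (ι₀ + ∑ j ∈ range n, τ j + Xtot) + (∑ j ∈ range n, τ j + Xsup) := by linarith
      exact mul_le_mul (mul_le_mul_of_nonneg_left h1 (by norm_num)) (mul_le_mul_of_nonneg_left ht' hb)
        (mul_nonneg hb (Nat.cast_nonneg t)) (mul_nonneg (by norm_num) hX0')
    obtain ⟨u, hu0, huU, hu⟩ := amplitudeLadder_envelope_edge B 𝒜 (n := t) hU hι₀ τ hτ0 X hX0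
      (fun i _ k k' => hXsup (i + 1) k k') hXtot' hXtot0 hXsup0 (fun i => δ (i + 1)) (hneg t htn hQt) h0 hsteps' hsmall'
    refine ⟨u, hu0, huU, fun k hk k' hk' => ?_⟩
    have hfro : ‖𝒜 n k k' - 𝒜 t k k'‖ ≤ Gtot + Xtot + ∑ i ∈ range n, ε i := by
      rcases htn.eq_or_lt with h | h
      · rw [h, sub_self, norm_zero]
        linarith
      · have hnot : ¬ InClass (t + 1) :=
          Nat.findGreatest_is_greatest (P := fun s => InClass s) (Nat.lt_succ_self t) (Nat.succ_le_of_lt h)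
        exact hfrozen t htn hnot k hk k' hk'
    have hlad := hu k hk k' hk'
    calc ‖𝒜 n k k' - (u : ℂ)‖ ≤ ‖𝒜 t k k' - (u : ℂ)‖ + ‖𝒜 n k k' - 𝒜 t k k'‖ := by
          rw [show 𝒜 n k k' - (u : ℂ) = (𝒜 t k k' - (u : ℂ)) + (𝒜 n k k' - 𝒜 t k k') by ring]
          exact norm_add_le _ _
      _ ≤ _ := by
          refine (add_le_add hlad hfro).trans ?_
          nlinarith [hSt, hι₀, hSt0, hXtot0, hXsup0]
  · -- never in the class: frozen from scale 0 around the bare value `U`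
    have hexit : ¬ InClass (0 + 1) := fun h => hQ0 (hmono h (Nat.zero_le 1))
    refine ⟨U, hU, by linarith, fun k hk k' hk' => ?_⟩
    have hfro := hfrozen 0 (Nat.zero_le n) hexit k hk k' hk'
    have h0' := h0 k hk k' hk'
    have hX0le : X 0 k k' ≤ Xtot :=
      (le_add_of_nonneg_right (sum_nonneg fun i _ => hX0 (i + 1) k k')).trans (hXtot k k')
    calc ‖𝒜 n k k' - (U : ℂ)‖ ≤ ‖𝒜 n k k' - 𝒜 0 k k'‖ + ‖𝒜 0 k k' - (U : ℂ)‖ := by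
          rw [show 𝒜 n k k' - (U : ℂ) = (𝒜 n k k' - 𝒜 0 k k') + (𝒜 0 k k' - (U : ℂ)) by ring]
          exact norm_add_le _ _
      _ ≤ _ := by
          refine (add_le_add hfro h0').trans ?_
          nlinarith [hSτ0, hι₀, hXtot0, hXsup0, hX0le]

end Summit.HubbardSuperconductivity.HubbardSuperconductivity.Theorems.SWaveCascade

end
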